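import Literature.AnabelianGeometry.SemiGraphs.Localizations
import Literature.AlgebraicGeometry.Frobenioids.Categories
import Mathlib.CategoryTheory.Galois.Basic
import Mathlib.CategoryTheory.Comma.Over.Basic
import Mathlib.SetTheory.Cardinal.Finite

/-!
# Categories of localizations, II ([SemiAnbd] §4: Def 4.2, Rmk 4.2.1–4.2.2, Prop 4.3, 4.5–4.7, Rmk 4.7.1, Thm 4.8, Rmk 4.8.1–4.8.4)

Mochizuki, *Semi-graphs of anabelioids*, Publ. RIMS **42** (2006), §4 pp.52–61 of the author's
manuscript (kurims `paper:url-f33ace170ff4`). [cite: MochizukiSemiAnbd2006, Def 4.2, p. 52]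

Over `Localizations.lean` (the category `Loc(𝔾, Γ)` = `LocObj 𝓥 G Γ` with its `Category`
instance) and the §§1–3 interface.  Contents, one declaration per printed sub-item:

* Def 4.2 (i) verticial / edge-wise length, nuclear objects, links, NL-morphisms, verticial
  morphisms, verticial degree; (ii) (strict) graph-localization morphisms — DEFINITIONS.
* Rmk 4.2.1 (locally trivial ⇔ excisive), Rmk 4.2.2 (embeddings are strict graph-localization
  morphisms; "the converse … false in general" is not typed), Prop 4.3 (i)–(vi), Prop 4.6
  (valuative criterion), Prop 4.7 (domination of links), Rmk 4.7.1 (domination of finite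
  collections), Thm 4.8 (slimness; category-theoreticity), Rmk 4.8.2 (i)–(v) — typed as
  `Prop`-valued STATEMENTS (`…Statement 𝓥 G Γ`), predicates on the interface data, not asserted
  and not proved here (Thm 4.8's proof is 969 words, pp.58–60).  BINDING: every statement is
  guarded by `LocHypotheses 𝓥 G Γ →` (p.51: the hypotheses under which alone the print DEFINES
  `Loc(𝔾, Γ)`), directly or through `CategoryTheoreticityHyp.loc`, so none asserts a printed
  conclusion for a pair `(𝔾, Γ)` the print never forms (e.g. Prop 4.3 (i) for a non-totally-elevated
  `𝔾`).  The closed named facts are these guarded predicates at the real vocabulary (TODO-merge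
  abc-iut-L3-t1/t2).
* "totally epimorphic" is the [FrdI] §0 notion already in the tree
  (`Literature.AlgebraicGeometry.Frobenioids.IsTotallyEpimorphic`: every arrow is epi), which is
  what Prop 4.3 (v) proves ("every morphism … is an epimorphism; in particular …"); "slim
  category" is `Frobenioids.IsSlim` ([SemiAnbd] §0 p.6 = [FrdI] §0); `Loc(𝔾, Γ)^⊥` is
  `Frobenioids.FiniteCoproductCompletion` ([SemiAnbd] §0 p.8 = [FrdI] §0 p.16); "Galois category"
  is Mathlib's `GaloisCategory`.
* Thm 4.8's "arises, up to unique isomorphism, from a unique isomorphism `𝔾₁ ⥲ 𝔾₂` together with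
  a compatible isomorphism `Γ₁ ⥲ Γ₂`" is rendered WITHOUT constructing the induced functor: there
  is a unique `α : G₁ ≅ G₂` conjugating `Γ₁` onto `Γ₂` such that `Φ` is naturally isomorphic,
  on underlying semi-graphs of anabelioids, to "keep the object, compose its structure morphisms
  with `α`" (`EquivInducedBy`).  Typed for the resp'd case `Loc(𝔾ᵢ, Γᵢ)`; the `Loc^fin` case is
  the same sentence on the full subcategory `finiteObjects` and is recorded in `…StatementFin`.

Deliberately NOT typed here (they quantify over the anabelioid `B(H)` / temperoid `B^temp(𝔾)` of a
semi-graph of anabelioids and over pull-backs of finite étale coverings, which the interface does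
not carry — TODO-merge abc-iut-L3-t1 §2 / t2 §3; to be typed in `LocalizationsAnabelioids.lean`):
Prop 4.4 (i)–(iv) (associated anabelioids), Prop 4.5's "in particular" clause
(`B^temp(𝔾)⁰ ↪ Loc(𝔾, Γ)`), Rmk 4.8.2's final clause (`Loc(𝔾, Γ)^⊥ ≃ B(𝔾)`), Rmk 4.8.4's second
clause (`C[A]^⊥` a connected quasi-anabelioid, Appendix Rmk A.4.2).  Rmk 4.8.3 ("the proof of
Theorem 4.8 may be simplified somewhat, by applying Proposition 4.5, Corollary 3.9" in the totally
estranged case) is a proof remark: expository, not typed.  Rmk 4.8.1 is typed over an explicit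
"maximal subgraph" input; Prop 4.5's first sentence and Rmk 4.8.4's first clause are typed.
-/

namespace Literature.AnabelianGeometry.SemiGraphs

open _root_.CategoryTheory Literature.AlgebraicGeometry.Frobenioids

universe u v w

variable {Obj : Type u} [Category.{v} Obj] (𝓥 : SemiAnbdVocab.{u, v, w} Obj)

namespace Loc

variable {G : Obj} {Γ : Subgroup (Aut G)}

/-! ### Definition 4.2 -/

namespace LocObj

/-- **Def 4.2 (i)**: the (possibly infinite) *verticial length* of an object = the cardinality of
the set of vertices of the underlying semi-graph (as an extended natural number).
[cite: MochizukiSemiAnbd2006, Def 4.2 (i), p. 52] -/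
noncomputable def vertLength (X : LocObj 𝓥 G Γ) : ℕ∞ := ENat.card (𝓥.Vert X.U)

/-- **Def 4.2 (i)**: the *edge-wise length* = the cardinality of the set of closed edges.
[cite: MochizukiSemiAnbd2006, Def 4.2 (i), p. 52] -/
noncomputable def edgeLength (X : LocObj 𝓥 G Γ) : ℕ∞ :=
  ENat.card {e : 𝓥.Edge X.U // 𝓥.IsClosedEdge e}

/-- A *finite* object: "objects of finite verticial length" (Thm 4.8, p.58), i.e. the finite open
and the closed objects. [cite: MochizukiSemiAnbd2006, Thm 4.8, p. 58] -/
def IsFiniteObj (X : LocObj 𝓥 G Γ) : Prop := X.vertLength 𝓥 ≠ ⊤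

/-- **Def 4.2 (i)**: a *nuclear object*: an open object of verticial length 1 and edge-wise length 0.
[cite: MochizukiSemiAnbd2006, Def 4.2 (i), p. 52] -/
def IsNuclear (X : LocObj 𝓥 G Γ) : Prop := X.IsOpenObj ∧ X.vertLength 𝓥 = 1 ∧ X.edgeLength 𝓥 = 0

/-- **Def 4.2 (i)**: a *link*: an open object of verticial length 2 and edge-wise length 1.
[cite: MochizukiSemiAnbd2006, Def 4.2 (i), p. 52] -/
def IsLink (X : LocObj 𝓥 G Γ) : Prop := X.IsOpenObj ∧ X.vertLength 𝓥 = 2 ∧ X.edgeLength 𝓥 = 1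

end LocObj

variable (G Γ) in
/-- `Loc(𝔾, Γ)^fin ⊆ Loc(𝔾, Γ)`: "the full subcategory determined by the finite objects" (Thm 4.8,
p.58), as an object property. [cite: MochizukiSemiAnbd2006, Thm 4.8, p. 58] -/
def finiteObjects : ObjectProperty (LocObj 𝓥 G Γ) := fun X => X.IsFiniteObj 𝓥

namespace LocHom

variable {X Y : LocObj 𝓥 G Γ}

/-- A *locally trivial* arrow of `Loc(𝔾, Γ)` (its underlying arrow is locally trivial, Def 2.2 (ii)).
[cite: MochizukiSemiAnbd2006, Def 4.2 (i), p. 52] -/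
def IsLocallyTrivial (f : X ⟶ Y) : Prop := 𝓥.IsLocallyTrivial f.hom

/-- **Def 4.2 (i)**: an *NL-morphism*: a locally trivial morphism from a nuclear object to a link.
[cite: MochizukiSemiAnbd2006, Def 4.2 (i), p. 52] -/
def IsNL (f : X ⟶ Y) : Prop := X.IsNuclear 𝓥 ∧ Y.IsLink 𝓥 ∧ IsLocallyTrivial 𝓥 f

/-- **Def 4.2 (i)**: a *verticial morphism*: a locally trivial morphism from a nuclear object to an
arbitrary object. [cite: MochizukiSemiAnbd2006, Def 4.2 (i), p. 52] -/
def IsVerticial (f : X ⟶ Y) : Prop := X.IsNuclear 𝓥 ∧ IsLocallyTrivial 𝓥 f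

/-- **Def 4.2 (i)**: the *verticial degree* of `H → K` at a vertex `v` of `H`: "the [necessarily
finite] degree of the finite étale morphism of anabelioids `H_v → K_w` induced by the arrow".
[cite: MochizukiSemiAnbd2006, Def 4.2 (i), p. 52] -/
def vertDegree (f : X ⟶ Y) (v : 𝓥.Vert X.U) : ℕ := 𝓥.vertDegree f.hom v

/-- **Def 4.2 (ii)**: a *graph-localization morphism*: a locally trivial morphism "which satisfies
the condition that it is an isomorphism whenever its domain is closed".
[cite: MochizukiSemiAnbd2006, Def 4.2 (ii), p. 52] -/
def IsGraphLocalization (f : X ⟶ Y) : Prop := IsLocallyTrivial 𝓥 f ∧ (X.IsClosed 𝓥 → IsIso f)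

/-- **Def 4.2 (ii)**: a *strict* graph-localization morphism: one whose underlying morphism of
semi-graphs is injective on vertices. [cite: MochizukiSemiAnbd2006, Def 4.2 (ii), p. 52] -/
def IsStrictGraphLocalization (f : X ⟶ Y) : Prop :=
  IsGraphLocalization 𝓥 f ∧ 𝓥.IsInjOnVertices f.hom

/-- An *embedding* in `Loc(𝔾, Γ)`: the underlying arrow is an embedding (Def 4.1 (ii)).
[cite: MochizukiSemiAnbd2006, Rmk 4.2.2, p. 52] -/
def IsEmbedding (f : X ⟶ Y) : Prop := 𝓥.IsEmbedding f.hom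

/-- An *excisive* arrow of `Loc(𝔾, Γ)` (Def 4.1 (ii)). [cite: MochizukiSemiAnbd2006, Rmk 4.2.1, p. 52] -/
def IsExcisive (f : X ⟶ Y) : Prop := 𝓥.IsExcision f.hom

/-- A *finite étale* arrow of `Loc(𝔾, Γ)` (its underlying arrow is a finite étale covering,
Def 2.2 (i); Prop 4.4, 4.6). [cite: MochizukiSemiAnbd2006, Prop 4.6, p. 56] -/
def IsFiniteEtale (f : X ⟶ Y) : Prop := 𝓥.IsFiniteEtale f.hom

end LocHom

variable (G Γ)

/-! ### Remarks 4.2.1, 4.2.2 (statements) -/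

/-- **Rmk 4.2.1**: "a morphism in `Loc(𝔾, Γ)` is locally trivial if and only if it is excisive"
[guarded, as every statement below, by the p.51 hypotheses `LocHypotheses`]. [cite: MochizukiSemiAnbd2006, Rmk 4.2.1, p. 52] -/
def LocallyTrivialIffExcisiveStatement (G : Obj) (Γ : Subgroup (Aut G)) : Prop :=
  LocHypotheses 𝓥 G Γ →
    ∀ (X Y : LocObj 𝓥 G Γ) (f : X ⟶ Y), LocHom.IsLocallyTrivial 𝓥 f ↔ LocHom.IsExcisive 𝓥 f

/-- **Rmk 4.2.2**: "every embedding in `Loc(𝔾, Γ)` is a strict graph-localization morphism" [the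
converse is false in general]. [cite: MochizukiSemiAnbd2006, Rmk 4.2.2, p. 52] -/
def EmbeddingIsStrictGraphLocalizationStatement (G : Obj) (Γ : Subgroup (Aut G)) : Prop :=
  LocHypotheses 𝓥 G Γ →
    ∀ (X Y : LocObj 𝓥 G Γ) (f : X ⟶ Y),
      LocHom.IsEmbedding 𝓥 f → LocHom.IsStrictGraphLocalization 𝓥 f

/-! ### Proposition 4.3 (Basic Properties of the Category of Localizations) — statements
(each guarded by `LocHypotheses 𝓥 G Γ`, p.51: the hypotheses under which `Loc(𝔾, Γ)` is defined) -/

/-- **Prop 4.3 (i)**: the underlying semi-graph of anabelioids of an object is connected,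
coherent, totally elevated, totally universally sub-coverticial, [totally aloof, verticially slim —
ambient] and of injective type; a finite open object has positive verticial length; the underlying
morphism of an arrow is locally finite étale. [cite: MochizukiSemiAnbd2006, Prop 4.3 (i), p. 52] -/
def BasicPropertiesStatementI (G : Obj) (Γ : Subgroup (Aut G)) : Prop :=
  LocHypotheses 𝓥 G Γ →
    (∀ X : LocObj 𝓥 G Γ, 𝓥.IsConnected X.U ∧ 𝓥.IsCoherent X.U ∧ 𝓥.IsTotallyElevated X.U ∧
        𝓥.IsTotallyUnivSubcoverticial X.U ∧ 𝓥.IsOfInjectiveType X.U ∧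
          (X.IsFiniteOpen 𝓥 → 0 < X.vertLength 𝓥)) ∧
      ∀ (X Y : LocObj 𝓥 G Γ) (f : X ⟶ Y), 𝓥.IsLocallyFiniteEtale f.hom

/-- **Prop 4.3 (ii)**: for a finite open object `H`, "any excision `H' → H` [of underlying
semi-graphs] of finite connected [semi-]graphs of positive verticial length determines an excision
`H' := H_{H'} → H` of `Loc(𝔾, Γ)`" — rendered: an excision `g : H' → H.U` from a finite connected
`H'` with a vertex carries a (necessarily unique) finite open structure making `g` an arrow of
`Loc(𝔾, Γ)`. [cite: MochizukiSemiAnbd2006, Prop 4.3 (ii), p. 52] -/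
def BasicPropertiesStatementII (G : Obj) (Γ : Subgroup (Aut G)) : Prop :=
  LocHypotheses 𝓥 G Γ →
    ∀ (X : LocObj 𝓥 G Γ), X.IsFiniteOpen 𝓥 → ∀ (H' : Obj) (g : H' ⟶ X.U), 𝓥.IsExcision g →
      𝓥.IsFinite H' → 𝓥.IsConnected H' → Nonempty (𝓥.Vert H') →
        ∃ L' : LocalGStructure 𝓥 G Γ H', IsFiniteOpenDatum 𝓥 H' L' ∧
          𝓥.IsLocallyFiniteEtale g ∧ L'.Compatible 𝓥 g X.L

/-- **Prop 4.3 (iii)**: a morphism from a finite open object to a tempered object "is not an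
isomorphism of semi-graphs of anabelioids". [cite: MochizukiSemiAnbd2006, Prop 4.3 (iii), p. 53] -/
def BasicPropertiesStatementIII (G : Obj) (Γ : Subgroup (Aut G)) : Prop :=
  LocHypotheses 𝓥 G Γ →
    ∀ (X Y : LocObj 𝓥 G Γ) (f : X ⟶ Y), X.IsFiniteOpen 𝓥 → Y.IsTemperedObj 𝓥 → ¬ IsIso f.hom

/-- **Prop 4.3 (iv)**: if `H` is a finite open object whose underlying semi-graph is a tree, "the
local `(𝔾, Γ)`-structure on `H` arises from a unique `(𝔾, Γ)`-structure on `H`" [hence from a (not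
necessarily unique) `𝔾`-structure]. [cite: MochizukiSemiAnbd2006, Prop 4.3 (iv), p. 53] -/
def BasicPropertiesStatementIV (G : Obj) (Γ : Subgroup (Aut G)) : Prop :=
  LocHypotheses 𝓥 G Γ →
    ∀ (X : LocObj 𝓥 G Γ), X.IsFiniteOpen 𝓥 → 𝓥.IsFiniteTree X.U →
      ∃! S : GStructure 𝓥 G Γ X.U,
        (∀ v, (X.L.atV v).mor = {t | ∃ s ∈ S.mor, t = 𝓥.ιV X.U v ≫ s}) ∧
          ∀ e, (X.L.atE e).mor = {t | ∃ s ∈ S.mor, t = 𝓥.ιE X.U e ≫ s}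

/-- **Prop 4.3 (v)**: "every morphism in `Loc(𝔾, Γ)` is an epimorphism.  In particular, the
category `Loc(𝔾, Γ)` is totally epimorphic." [cite: MochizukiSemiAnbd2006, Prop 4.3 (v), p. 53] -/
def BasicPropertiesStatementV (G : Obj) (Γ : Subgroup (Aut G)) : Prop :=
  LocHypotheses 𝓥 G Γ →
    (∀ (X Y : LocObj 𝓥 G Γ) (f : X ⟶ Y), Epi f) ∧ IsTotallyEpimorphic (LocObj 𝓥 G Γ)

/-- **Prop 4.3 (vi)**: "every endomorphism of a finite [open or closed] object of `Loc(𝔾, Γ)` is an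
automorphism.  Moreover, the automorphism group of any finite object of `Loc(𝔾, Γ)` is finite."
[cite: MochizukiSemiAnbd2006, Prop 4.3 (vi), p. 53] -/
def BasicPropertiesStatementVI (G : Obj) (Γ : Subgroup (Aut G)) : Prop :=
  LocHypotheses 𝓥 G Γ →
    ∀ X : LocObj 𝓥 G Γ, X.IsFiniteObj 𝓥 → (∀ f : X ⟶ X, IsIso f) ∧ Finite (Aut X)

/-! ### Proposition 4.5 (The Subcategory of Tempered Objects) — first sentence -/

/-- **Prop 4.5**, first sentence: "let `H`, `K` be tempered objects of `Loc(𝔾, Γ)`.  Then every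
morphism `H → K` in `Loc(𝔾, Γ)` is a tempered covering."  [The "in particular" clause — a natural
full embedding `B^temp(𝔾)⁰ ↪ Loc(𝔾, Γ)` with essential image the tempered objects — needs t2's
temperoid `B^temp(𝔾)` and is not typed here.] [cite: MochizukiSemiAnbd2006, Prop 4.5, p. 55] -/
def TemperedMorphismsStatement (G : Obj) (Γ : Subgroup (Aut G)) : Prop :=
  LocHypotheses 𝓥 G Γ →
    ∀ (X Y : LocObj 𝓥 G Γ) (f : X ⟶ Y),
      X.IsTemperedObj 𝓥 → Y.IsTemperedObj 𝓥 → 𝓥.IsTempered f.hom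

/-! ### Proposition 4.6 (Valuative Criterion for Finite Étale Morphisms) — statement -/

/-- **Prop 4.6**: for a morphism `φ : H → K` between finite objects, `φ` is finite étale iff for
every NL-morphism `H₀ → H₁` and every commutative square `H₀ → H₁`, `H₀ → H`, `H₁ → K`, there is an
NL-morphism `H₀ → H₂` through which `H₀ → H₁` factors (`H₂ → H₁`) such that the composite square
admits a morphism `H₂ → H` making the two triangles commute.
[cite: MochizukiSemiAnbd2006, Prop 4.6, p. 56] -/
def ValuativeCriterionStatement (G : Obj) (Γ : Subgroup (Aut G)) : Prop :=
  LocHypotheses 𝓥 G Γ →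
    ∀ (X Y : LocObj 𝓥 G Γ) (φ : X ⟶ Y), X.IsFiniteObj 𝓥 → Y.IsFiniteObj 𝓥 →
      (LocHom.IsFiniteEtale 𝓥 φ ↔
        ∀ (H₀ H₁ : LocObj 𝓥 G Γ) (ν : H₀ ⟶ H₁) (a : H₀ ⟶ X) (b : H₁ ⟶ Y),
          LocHom.IsNL 𝓥 ν → a ≫ φ = ν ≫ b →
            ∃ (H₂ : LocObj 𝓥 G Γ) (ν₂ : H₀ ⟶ H₂) (c : H₂ ⟶ H₁) (d : H₂ ⟶ X),
              LocHom.IsNL 𝓥 ν₂ ∧ ν₂ ≫ c = ν ∧ ν₂ ≫ d = a ∧ d ≫ φ = c ≫ b)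

/-! ### Proposition 4.7 (Domination of Links), Remark 4.7.1 — statements -/

/-- `ν₁ : H₀ → H₁`, `ν₂ : H₀ → H₂` are NL-morphisms and "the unique closed edge of `Hᵢ` is the image
of the same edge of `H₀`". [cite: MochizukiSemiAnbd2006, Prop 4.7, p. 57] -/
def HaveCommonEdge {H₀ H₁ H₂ : LocObj 𝓥 G Γ} (ν₁ : H₀ ⟶ H₁) (ν₂ : H₀ ⟶ H₂) : Prop :=
  ∃ e₀ : 𝓥.Edge H₀.U, 𝓥.IsClosedEdge (𝓥.mapE ν₁.hom e₀) ∧ 𝓥.IsClosedEdge (𝓥.mapE ν₂.hom e₀)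

/-- **Prop 4.7**: two NL-morphisms `H₀ → H₁`, `H₀ → H₂` whose links' closed edges come from the same
edge of `H₀` are dominated by an NL-morphism `H₀ → H₃` (commutative triangles `H₀ → H₃ → Hᵢ`).
[cite: MochizukiSemiAnbd2006, Prop 4.7, p. 57] -/
def DominationOfLinksStatement (G : Obj) (Γ : Subgroup (Aut G)) : Prop :=
  LocHypotheses 𝓥 G Γ →
    ∀ (H₀ H₁ H₂ : LocObj 𝓥 G Γ) (ν₁ : H₀ ⟶ H₁) (ν₂ : H₀ ⟶ H₂),
      LocHom.IsNL 𝓥 ν₁ → LocHom.IsNL 𝓥 ν₂ → HaveCommonEdge 𝓥 G Γ ν₁ ν₂ →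
        ∃ (H₃ : LocObj 𝓥 G Γ) (ν₃ : H₀ ⟶ H₃) (c₁ : H₃ ⟶ H₁) (c₂ : H₃ ⟶ H₂),
          LocHom.IsNL 𝓥 ν₃ ∧ ν₃ ≫ c₁ = ν₁ ∧ ν₃ ≫ c₂ = ν₂

/-- **Rmk 4.7.1** (first claim): "by applying Proposition 4.7 in an iterative fashion, one may
construct an NL-morphism with domain `H₀` that dominates an arbitrary given finite collection of
NL-morphisms `H₀ → Hᵢ`" whose closed edges are images of the same edge of `H₀`.  [The remaining
sentences — two dominating NL-morphisms are dominated by a third (Prop 4.7), and the two induced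
arrows `H_c → Hᵢ` coincide (Prop 4.3 (v)), yielding "a natural system of dominating NL-morphisms" —
are consequences recorded, not separately typed.] [cite: MochizukiSemiAnbd2006, Rmk 4.7.1, p. 58] -/
def FiniteDominationStatement (G : Obj) (Γ : Subgroup (Aut G)) : Prop :=
  LocHypotheses 𝓥 G Γ →
    ∀ (n : ℕ) (H₀ : LocObj 𝓥 G Γ) (H : Fin n → LocObj 𝓥 G Γ) (ν : ∀ i, H₀ ⟶ H i)
      (e₀ : 𝓥.Edge H₀.U),
      (∀ i, LocHom.IsNL 𝓥 (ν i) ∧ 𝓥.IsClosedEdge (𝓥.mapE (ν i).hom e₀)) → 0 < n →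
        ∃ (K : LocObj 𝓥 G Γ) (μ : H₀ ⟶ K) (c : ∀ i, K ⟶ H i),
          LocHom.IsNL 𝓥 μ ∧ ∀ i, μ ≫ c i = ν i

/-! ### Theorem 4.8 (Category-Theoreticity of Categories of Localizations) — statement -/

/-- Hypotheses of Thm 4.8 on `(𝔾, Γ)`: those making `Loc(𝔾, Γ)` defined, `𝔾` a GRAPH of
anabelioids, with at least one edge. [cite: MochizukiSemiAnbd2006, Thm 4.8, p. 58] -/
structure CategoryTheoreticityHyp : Prop where
  /-- `Loc(𝔾, Γ)` is defined (finite `Γ` acting piecewise faithfully; `𝔾` finite, connected,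
  coherent, totally elevated, totally universally sub-coverticial) -/
  loc : LocHypotheses 𝓥 G Γ
  /-- the underlying semi-graph of `𝔾` is a graph -/
  isGraph : 𝓥.IsGraph G
  /-- `𝔾` has at least one edge -/
  hasEdge : Nonempty (𝓥.Edge G)

variable {G Γ} {G₂ : Obj} {Γ₂ : Subgroup (Aut G₂)}

/-- "`Φ` arises from the isomorphism `α : 𝔾₁ ⥲ 𝔾₂`": on underlying semi-graphs of anabelioids, `Φ`
is naturally isomorphic to the identity, compatibly with structure morphisms composed with `α`
(tempered objects: `𝔾`-structures; all objects: the local `(𝔾, Γ)`-structures).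
[cite: MochizukiSemiAnbd2006, Thm 4.8, p. 58] -/
def EquivInducedBy (Φ : LocObj 𝓥 G Γ ⥤ LocObj 𝓥 G₂ Γ₂) (α : G ≅ G₂) : Prop :=
  ∃ η : ∀ X : LocObj 𝓥 G Γ, (Φ.obj X).U ≅ X.U,
    (∀ (X Y : LocObj 𝓥 G Γ) (f : X ⟶ Y), (Φ.map f).hom ≫ (η Y).hom = (η X).hom ≫ f.hom) ∧
      (∀ (X : LocObj 𝓥 G Γ) (p : X.U ⟶ G), X.str = some p →
        (Φ.obj X).str = some ((η X).hom ≫ p ≫ α.hom)) ∧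
      (∀ X : LocObj 𝓥 G Γ, X.str = none → (Φ.obj X).str = none) ∧
      (∀ (X : LocObj 𝓥 G Γ) (v : 𝓥.Vert (Φ.obj X).U) (v' : 𝓥.Vert X.U)
          (h : 𝓥.mapV (η X).hom v = v'),
        ((Φ.obj X).L.atV v).mor =
          {t | ∃ s ∈ (X.L.atV v').mor, t = 𝓥.locMapV (η X).hom v v' h ≫ s ≫ α.hom}) ∧
      ∀ (X : LocObj 𝓥 G Γ) (e : 𝓥.Edge (Φ.obj X).U) (e' : 𝓥.Edge X.U)
          (h : 𝓥.mapE (η X).hom e = e'),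
        ((Φ.obj X).L.atE e).mor =
          {t | ∃ s ∈ (X.L.atE e').mor, t = 𝓥.locMapE (η X).hom e e' h ≫ s ≫ α.hom}

/-- `α : 𝔾₁ ⥲ 𝔾₂` is compatible with `Γ₁`, `Γ₂`: conjugation by `α` carries `Γ₁` onto `Γ₂` ("together
with a compatible isomorphism `Γ₁ ⥲ Γ₂`", which is then conjugation by `α`).
[cite: MochizukiSemiAnbd2006, Thm 4.8, p. 58] -/
def ConjugatesInto (α : G ≅ G₂) (Γ₁ : Subgroup (Aut G)) (Γ₂' : Subgroup (Aut G₂)) : Prop :=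
  ∀ γ₂ : Aut G₂, γ₂ ∈ Γ₂' ↔ ∃ γ ∈ Γ₁, γ₂.hom = α.inv ≫ γ.hom ≫ α.hom

variable (G Γ G₂ Γ₂)

/-- **Thm 4.8, slimness**: under the hypotheses, "the categories `Loc(𝔾, Γ)^fin` (respectively,
`Loc(𝔾, Γ)`) are slim". [cite: MochizukiSemiAnbd2006, Thm 4.8, p. 58] -/
def SlimStatement (G : Obj) (Γ : Subgroup (Aut G)) : Prop :=
  CategoryTheoreticityHyp 𝓥 G Γ →
    IsSlim ((finiteObjects 𝓥 G Γ).FullSubcategory) ∧ IsSlim (LocObj 𝓥 G Γ)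

/-- **Thm 4.8, category-theoreticity** (resp'd case): every equivalence
`Φ : Loc(𝔾₁, Γ₁) ⥲ Loc(𝔾₂, Γ₂)` "arises, up to unique isomorphism, from a unique isomorphism of graphs
of anabelioids `𝔾₁ ⥲ 𝔾₂` together with a compatible isomorphism `Γ₁ ⥲ Γ₂`".
[cite: MochizukiSemiAnbd2006, Thm 4.8, p. 58] -/
def CategoryTheoreticityStatement (G : Obj) (Γ : Subgroup (Aut G)) (G₂ : Obj) (Γ₂ : Subgroup (Aut G₂)) : Prop :=
  CategoryTheoreticityHyp 𝓥 G Γ → CategoryTheoreticityHyp 𝓥 G₂ Γ₂ →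
    ∀ Φ : LocObj 𝓥 G Γ ≌ LocObj 𝓥 G₂ Γ₂,
      ∃! α : G ≅ G₂, ConjugatesInto α Γ Γ₂ ∧ EquivInducedBy 𝓥 Φ.functor α

/-- **Thm 4.8, category-theoreticity** (the `Loc^fin` case): every equivalence
`Loc(𝔾₁, Γ₁)^fin ⥲ Loc(𝔾₂, Γ₂)^fin` arises, up to unique isomorphism, from a unique compatible pair of
isomorphisms — rendered on the full subcategories of finite objects by the same clauses as
`EquivInducedBy` for the underlying objects. [cite: MochizukiSemiAnbd2006, Thm 4.8, p. 58] -/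
def CategoryTheoreticityStatementFin (G : Obj) (Γ : Subgroup (Aut G)) (G₂ : Obj) (Γ₂ : Subgroup (Aut G₂)) : Prop :=
  CategoryTheoreticityHyp 𝓥 G Γ → CategoryTheoreticityHyp 𝓥 G₂ Γ₂ →
    ∀ Φ : (finiteObjects 𝓥 G Γ).FullSubcategory ≌ (finiteObjects 𝓥 G₂ Γ₂).FullSubcategory,
      ∃! α : G ≅ G₂, ConjugatesInto α Γ Γ₂ ∧
        ∃ η : ∀ X : (finiteObjects 𝓥 G Γ).FullSubcategory, (Φ.functor.obj X).obj.U ≅ X.obj.U,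
          (∀ (X Y : (finiteObjects 𝓥 G Γ).FullSubcategory) (f : X ⟶ Y),
              (Φ.functor.map f).hom.hom ≫ (η Y).hom = (η X).hom ≫ f.hom.hom) ∧
            (∀ (X : (finiteObjects 𝓥 G Γ).FullSubcategory) (p : X.obj.U ⟶ G),
              X.obj.str = some p → (Φ.functor.obj X).obj.str = some ((η X).hom ≫ p ≫ α.hom)) ∧
            ∀ X : (finiteObjects 𝓥 G Γ).FullSubcategory,
              X.obj.str = none → (Φ.functor.obj X).obj.str = none

variable {G₂ Γ₂}

/-! ### Remark 4.8.1 (statement over an explicit maximal-subgraph input) -/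

/-- `ι : H → 𝔾` exhibits `H` as (the restriction of `𝔾` to) the maximal subgraph of `𝔾` (§1 p.13:
omit the open edges): an embedding, bijective on vertices, whose image on edges is exactly the
closed edges. [cite: MochizukiSemiAnbd2006, Rmk 4.8.1, p. 60] -/
def IsMaximalSubgraphInclusion {H : Obj} (ι : H ⟶ G) : Prop :=
  𝓥.IsEmbedding ι ∧ Function.Bijective (𝓥.mapV ι) ∧
    ∀ e : 𝓥.Edge G, 𝓥.IsClosedEdge e ↔ e ∈ Set.range (𝓥.mapE ι)

/-- **Rmk 4.8.1**: if `𝔾` has a vertex and `ℍ := 𝔾_H` is its maximal subgraph with the induced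
(piecewise faithful) action of `Γ`, then `Loc(ℍ, Γ)` is defined and there are natural equivalences
`Loc(𝔾, Γ)^fin ⥲ Loc(ℍ, Γ)^fin`, `Loc(𝔾, Γ) ⥲ Loc(ℍ, Γ)` [omit all `𝔾`-open edges] — typed over an
explicit maximal-subgraph inclusion `ι` and a subgroup `Γ' ≤ Aut ℍ` corresponding to `Γ` under `ι`.
[cite: MochizukiSemiAnbd2006, Rmk 4.8.1, p. 60] -/
def MaximalSubgraphStatement (G : Obj) (Γ : Subgroup (Aut G)) : Prop :=
  LocHypotheses 𝓥 G Γ → Nonempty (𝓥.Vert G) →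
    ∀ (H : Obj) (ι : H ⟶ G) (Γ' : Subgroup (Aut H)), IsMaximalSubgraphInclusion 𝓥 G ι →
      (∀ γ' : Aut H, γ' ∈ Γ' ↔ ∃ γ ∈ Γ, γ'.hom ≫ ι = ι ≫ γ.hom) →
        LocHypotheses 𝓥 H Γ' ∧ Nonempty (LocObj 𝓥 G Γ ≌ LocObj 𝓥 H Γ') ∧
          Nonempty ((finiteObjects 𝓥 G Γ).FullSubcategory ≌ (finiteObjects 𝓥 H Γ').FullSubcategory)

/-! ### Remark 4.8.2 (statement) -/

/-- **Rmk 4.8.2**: whenever `Loc(𝔾, Γ)` is defined, the following are equivalent: (i) `𝔾` has no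
closed edges; (ii) `𝔾` is a tree with at most one vertex; (iii) `Loc(𝔾, Γ)^⊥` is a Galois category;
(iv) every monomorphism of `Loc(𝔾, Γ)` is an isomorphism; (v) every object of `Loc(𝔾, Γ)` is closed.
[The final clause "`Loc(𝔾, Γ)^⊥ ≃ B(𝔾)`" needs t1's `B(𝔾)`: not typed here.]
[cite: MochizukiSemiAnbd2006, Rmk 4.8.2, p. 60] -/
def DegenerateCasesStatement (G : Obj) (Γ : Subgroup (Aut G)) : Prop :=
  LocHypotheses 𝓥 G Γ →
    let P₁ := ∀ e : 𝓥.Edge G, ¬ 𝓥.IsClosedEdge e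
    let P₂ := 𝓥.IsFiniteTree G ∧ Nat.card (𝓥.Vert G) ≤ 1
    let P₃ := GaloisCategory (FiniteCoproductCompletion.{0} (LocObj 𝓥 G Γ))
    let P₄ := ∀ (X Y : LocObj 𝓥 G Γ) (f : X ⟶ Y), Mono f → IsIso f
    let P₅ := ∀ X : LocObj 𝓥 G Γ, X.IsClosed 𝓥
    (P₁ ↔ P₂) ∧ (P₂ ↔ P₃) ∧ (P₃ ↔ P₄) ∧ (P₄ ↔ P₅)

/-! ### Remark 4.8.4 (first clause) -/

/-- **Rmk 4.8.4**, first clause: "if an object `A` of `C` [`= Loc(𝔾, Γ)^fin` or `Loc(𝔾, Γ)`] is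
nuclear, then the category `C_A^⊥` is easily verified to be a connected anabelioid" — i.e. a Galois
category (§2 p.22: "connected anabelioid [i.e., a Galois category]"); typed for `C = Loc(𝔾, Γ)` with
Mathlib's `GaloisCategory` and `C^⊥ = FiniteCoproductCompletion`.  [Second clause, "`C[A]^⊥` is a
connected quasi-anabelioid (Rmk A.4.2)", needs the Appendix and is not typed.]
[cite: MochizukiSemiAnbd2006, Rmk 4.8.4, p. 61] -/
def NuclearSliceGaloisStatement (G : Obj) (Γ : Subgroup (Aut G)) : Prop :=
  LocHypotheses 𝓥 G Γ → ∀ A : LocObj 𝓥 G Γ, A.IsNuclear 𝓥 →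
    GaloisCategory (FiniteCoproductCompletion.{0} (Over A))

end Loc

end Literature.AnabelianGeometry.SemiGraphs
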